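import Summits.QuantumAdvantage.QuantumAdvantage.Theorems.CubicForrelationNearExactIsExactTowerWalk
import Summits.QuantumAdvantage.QuantumAdvantage.Theorems.CubicForrelationNearExactIsExactSixteenThirtyOneThirtySeconds
import Summits.QuantumAdvantage.QuantumAdvantage.Theorems.CubicForrelationNearExactIsExactEighteenSixtyThreeSixtyFourths

/-!
# Crux `CubicForrelation.NearExactIsExact` (stmt-QuantumAdvantage-14043) — the ENVELOPE of the `θ_n` ladder, uniform in `n`:
  `θ_n` exists, is non-decreasing in `n`, satisfies `15/16 ≤ θ_n ≤ 1 − 2^{−⌊n/3⌋−1}` (`n ≥ 16`), and the crux is a TAIL statement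

Certificate seat `b2b-cforr-cert` (gen 4, 2026-08-19).  HONEST FRAMING: the value here is a handful of THEOREMS, uniform in `n`, about the
shape of the certified ladder `θ_8 = 13/16, θ_10 = 7/8, θ_12 ∈ [57/64,15/16], θ_14 ∈ [57/64,31/32], θ_16 ∈ [15/16,31/32],
θ_18 ∈ [15/16,63/64]` (`…ThetaLadder.lean` and successors) — NOT summit progress: the crux asks for ONE `θ < 1` serving every even
`n`, and nothing below decides that.

For even `n` write `Isol_n(θ)` for "every pair of cubic Boolean functions `f, g : 𝔽₂ⁿ → 𝔽₂` with `Φ(f,g) > θ` is exact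
(`Φ(f,g) = 1`)" and `θ_n` for the least such `θ` (the largest forrelation value `≠ 1` of a cubic pair on `n` bits).  This file
proves, for the literal predicate written out (no definitions are introduced):

* `theta_exists`: for every `n` the set `{θ | Isol_n(θ)}` HAS a least element (it is `[θ_n, ∞)` with `θ_n` the maximum of the
  finitely many non-exact cubic forrelation values) — so the `θ_n` of the ladder's docstrings is well defined at every `n`.
* `isolates_of_add_two`, `isolates_mono`: **`Isol_{n+2}(θ) ⇒ Isol_n(θ)`**, hence `Isol_{n'}(θ) ⇒ Isol_n(θ)` for even `n ≤ n'` and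
  `θ_n ≤ θ_{n'}` (`theta_mono`): pad a pair on `n` bits with the exact 2-bit bent pair `(z₀z₁, z₀z₁)`; `Φ` is multiplicative
  under direct sums (`forrelation_directSum`, Literature) and the padding keeps degree `3` (`forrelation_pad`, `isDegLeFun_pad`).
* `isolation_rate`, `isolation_rate_even`: **the tower's rate, uniform in `n`: for every `m ≥ 3` and all cubic `f, g` on `m + m`
  bits, `Φ(f,g) > 1 − 2^{−(⌊2m/3⌋+1)} ⇒ Φ(f,g) = 1`**, i.e. `θ_n ≤ 1 − 2^{−⌊n/3⌋−1}` for every even `n ≥ 6`.  This is the generic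
  walk `tower_walk_closed` of `…TowerWalk.lean` with the optimal uniform cost exponent `C(m) = ⌊2m/3⌋ + 1` (the Ax base level
  `j₀ = ⌈2m/3⌉` is the most expensive one; `omega`) joined with the bent endgame `tw_bent_end` (Hou: dual degree
  `≤ ⌊(m+3)/2⌋ ≤ C(m) + 1`).  It reproduces the tree's per-`n` tower constants (`7/8, 7/8, 15/16, 31/32, 31/32, 63/64, 127/128` at
  `n = 6, …, 18`, `1 − 2⁻¹⁰` at `n = 28`) as ONE statement and gives every `n ≥ 30` its first isolation constant better than value
  granularity (`n = 30`: `2047/2048`, `isolation_thirty`).  The digit/tiling refinements of the certificate seats (`13/16` at `8`,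
  `15/16` at `12`, `31/32` at `16`, `63/64` at `18`) beat the rate by one factor of `2` at those `n` and are not reproduced here.
* `le_of_isolates_ge_sixteen`: **no `θ < 15/16` isolates exactness at any even `n ≥ 16`** (monotonicity from the `n = 16` witness
  `Φ(f16,g16) = 15/16`, `theta_sixteen_bounds_31_32`); with the rate: `θ_n ∈ [15/16, 1 − 2^{−⌊n/3⌋−1}]` for every even `n ≥ 16`,
  e.g. `theta_twenty_bounds`: `θ_20 ∈ [15/16, 127/128]` (new row; the tree had `1 − 2⁻¹⁰` at `n = 20`).
* `nearExactIsExact_iff_eventually`: **the crux is a statement about the TAIL of the ladder only**: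
  `NearExactIsExact ↔ ∃ θ < 1, ∃ N, ∀ even n ≥ N, Isol_n(θ)` — by monotonicity ANY tail suffices, with no separate treatment of
  small `n` (the tree's `nearExactIsExact_iff_from_thirty` needed the certified constants below `30`; here `N` is arbitrary).
  Equivalently the crux says `lim_n θ_n = sup_n θ_n < 1` for the non-decreasing sequence `θ_n ≥ 15/16`.

References: S. Aaronson, A. Ambainis, *Forrelation*, SIAM J. Comput. 47 (2018) §1.1.1 (definition of `Φ`, multiplicativity over
blocks); J. Ax (1964) / R. J. McEliece (1972) divisibility and X.-D. Hou, Discrete Math. 189 (1998) (cubic bent duals) as used in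
`…TowerWalk.lean` / `…IsolationSmallN.lean`.  Everything below is proved from Mathlib and the tree; axioms are the standard three;
no `decide`/`native_decide`, no definitions.
-/

set_option linter.dupNamespace false -- D-0017: single-problem summit ⇒ `QuantumAdvantage.QuantumAdvantage` by design

noncomputable section

namespace Summit.QuantumAdvantage.QuantumAdvantage.Theorems.CubicForrelation.NearExactIsExact

open Finset
open Literature.Computability.QuantumComplexity
open Literature.Computability.QuantumComplexity.DerivativeWalsh (W)
open Summit.QuantumAdvantage.QuantumAdvantage.Theses.CubicForrelation (NearExactIsExact)

/-! ### `θ_n` exists at every `n` -/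

/-- **The isolation threshold `θ_n` exists.** For every `n`, the set of reals `θ` such that every cubic pair `f, g : 𝔽₂ⁿ → 𝔽₂`
with `Φ(f,g) > θ` is exact has a LEAST element — namely the largest forrelation value `≠ 1` of a cubic pair on `n` bits (a
maximum over a finite non-empty set: the constant pair `(0,0)` or `(0,1)` is cubic and non-exact).  So `θ_n` is well defined.
[this work] -/
theorem theta_exists (n : ℕ) : ∃ θ₀ : ℝ, IsLeast {θ : ℝ | ∀ f g : (Fin n → Bool) → Bool, IsDegLeFun 3 f → IsDegLeFun 3 g →
    θ < forrelation f g → forrelation f g = 1} θ₀ := by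
  classical
  set S : Finset (((Fin n → Bool) → Bool) × ((Fin n → Bool) → Bool)) :=
    univ.filter fun p => IsDegLeFun 3 p.1 ∧ IsDegLeFun 3 p.2 ∧ forrelation p.1 p.2 ≠ 1 with hS
  have hne : S.Nonempty := by
    by_cases h0 : forrelation (fun _ : Fin n → Bool => false) (fun _ => false) = 1
    · refine ⟨((fun _ => false), (fun _ => true)), ?_⟩
      rw [hS, mem_filter]
      refine ⟨mem_univ _, isDegLeFun_const 3 false, isDegLeFun_const 3 true, ?_⟩
      have h : forrelation (fun _ : Fin n → Bool => false) (fun _ => true) =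
          -forrelation (fun _ : Fin n → Bool => false) (fun _ => false) :=
        DerivativeWalsh.forrelation_not_right (fun _ : Fin n → Bool => false) (fun _ : Fin n → Bool => false)
      rw [h, h0]
      norm_num
    · refine ⟨((fun _ => false), (fun _ => false)), ?_⟩
      rw [hS, mem_filter]
      exact ⟨mem_univ _, isDegLeFun_const 3 false, isDegLeFun_const 3 false, h0⟩
  obtain ⟨p₀, hp₀, hmax⟩ := S.exists_max_image (fun p => forrelation p.1 p.2) hne
  have hp : IsDegLeFun 3 p₀.1 ∧ IsDegLeFun 3 p₀.2 ∧ forrelation p₀.1 p₀.2 ≠ 1 := by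
    rw [hS, mem_filter] at hp₀
    exact hp₀.2
  refine ⟨forrelation p₀.1 p₀.2, fun f g hf hg hlt => ?_, fun θ hθ => ?_⟩
  · by_contra hne1
    have hmem : (f, g) ∈ S := by
      rw [hS, mem_filter]
      exact ⟨mem_univ _, hf, hg, hne1⟩
    have hle := hmax (f, g) hmem
    exact absurd hlt (not_lt.2 hle)
  · by_contra hlt
    push Not at hlt
    exact hp.2.2 (hθ p₀.1 p₀.2 hp.1 hp.2.1 hlt)

/-! ### Monotonicity in `n`: pad with the exact 2-bit pair -/

/-- **Padding with the exact 2-bit bent pair does not change `Φ`:** `Φ(f ⊕ z₀z₁, g ⊕ z₀z₁) = Φ(f,g) · Φ(z₀z₁, z₀z₁) = Φ(f,g)`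
(`forrelation_directSum`, `ei_forrelation_and2`). [cite: AaronsonAmbainis2018, §1.1.1] -/
theorem forrelation_pad {n : ℕ} (f g : (Fin n → Bool) → Bool) :
    forrelation (n := n + (1 + 1))
      (fun x => xor (f fun i => x (Fin.castAdd (1 + 1) i))
        ((fun z : Fin (1 + 1) → Bool => z 0 && z 1) fun j => x (Fin.natAdd n j)))
      (fun y => xor (g fun i => y (Fin.castAdd (1 + 1) i))
        ((fun z : Fin (1 + 1) → Bool => z 0 && z 1) fun j => y (Fin.natAdd n j))) = forrelation f g := by
  rw [forrelation_directSum f g (fun z : Fin (1 + 1) → Bool => z 0 && z 1) (fun z : Fin (1 + 1) → Bool => z 0 && z 1),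
    ei_forrelation_and2, mul_one]

/-- The padding `f ⊕ z₀z₁` of a function of degree `≤ d` (`d ≥ 2`) has degree `≤ d`. [folklore] -/
theorem isDegLeFun_pad {n d : ℕ} (hd : 2 ≤ d) {f : (Fin n → Bool) → Bool} (hf : IsDegLeFun d f) :
    IsDegLeFun d (fun x : Fin (n + (1 + 1)) → Bool => xor (f fun i => x (Fin.castAdd (1 + 1) i))
      ((fun z : Fin (1 + 1) → Bool => z 0 && z 1) fun j => x (Fin.natAdd n j))) :=
  bb_isDegLeFun_bxor
    (fc_isDegLeFun_comp hf (fun x i => x (Fin.castAdd (1 + 1) i)) (fun v => isDegLeFun_apply _ le_rfl) (by omega))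
    (fc_isDegLeFun_comp (ei_isDegLeFun_and2.mono hd) (fun x j => x (Fin.natAdd n j)) (fun v => isDegLeFun_apply _ le_rfl)
      (by omega))

/-- Transport of the isolation predicate along an equality of bit counts (bookkeeping). [folklore] -/
theorem isolates_cast {θ : ℝ} {N N' : ℕ} (e : N = N')
    (h : ∀ f g : (Fin N' → Bool) → Bool, IsDegLeFun 3 f → IsDegLeFun 3 g → θ < forrelation f g → forrelation f g = 1) :
    ∀ f g : (Fin N → Bool) → Bool, IsDegLeFun 3 f → IsDegLeFun 3 g → θ < forrelation f g → forrelation f g = 1 := by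
  subst e
  exact h

/-- **Monotonicity step: if `θ` isolates exactness for cubic pairs on `n + 2` bits, it does so on `n` bits.**  Given cubic `f, g`
on `n` bits with `Φ(f,g) > θ`, the padded pair on `n + 2` bits is cubic with the same `Φ`, hence exact, hence so is `(f,g)`.
[this work] -/
theorem isolates_of_add_two {n : ℕ} {θ : ℝ}
    (h : ∀ f g : (Fin (n + 2) → Bool) → Bool, IsDegLeFun 3 f → IsDegLeFun 3 g → θ < forrelation f g → forrelation f g = 1) :
    ∀ f g : (Fin n → Bool) → Bool, IsDegLeFun 3 f → IsDegLeFun 3 g → θ < forrelation f g → forrelation f g = 1 := by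
  intro f g hf hg hlt
  have key := h _ _ (isDegLeFun_pad (by norm_num) hf) (isDegLeFun_pad (by norm_num) hg)
  rw [forrelation_pad] at key
  exact key hlt

/-- Monotonicity, iterated: isolation on `N + 2k` bits implies isolation on `N` bits. [this work] -/
theorem isolates_of_add_two_mul {θ : ℝ} (k N : ℕ)
    (h : ∀ f g : (Fin (N + 2 * k) → Bool) → Bool, IsDegLeFun 3 f → IsDegLeFun 3 g → θ < forrelation f g → forrelation f g = 1) :
    ∀ f g : (Fin N → Bool) → Bool, IsDegLeFun 3 f → IsDegLeFun 3 g → θ < forrelation f g → forrelation f g = 1 := by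
  induction k with
  | zero => exact isolates_cast (N' := N + 2 * 0) (by omega) h
  | succ k ih =>
    exact ih (isolates_of_add_two (isolates_cast (N' := N + 2 * (k + 1)) (by omega) h))

/-- **`Isol_{n'}(θ) ⇒ Isol_n(θ)` for even `n ≤ n'`:** an isolation constant valid at an even bit count is valid at every smaller
even bit count. [this work] -/
theorem isolates_mono {θ : ℝ} {n n' : ℕ} (hn : Even n) (hn' : Even n') (hle : n ≤ n')
    (h : ∀ f g : (Fin n' → Bool) → Bool, IsDegLeFun 3 f → IsDegLeFun 3 g → θ < forrelation f g → forrelation f g = 1) :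
    ∀ f g : (Fin n → Bool) → Bool, IsDegLeFun 3 f → IsDegLeFun 3 g → θ < forrelation f g → forrelation f g = 1 := by
  obtain ⟨k, hk⟩ : ∃ k, n' = n + 2 * k := by
    obtain ⟨a, rfl⟩ := hn
    obtain ⟨b, rfl⟩ := hn'
    exact ⟨b - a, by omega⟩
  exact isolates_of_add_two_mul k n (isolates_cast hk.symm h)

/-- **`θ_n ≤ θ_{n'}` for even `n ≤ n'`:** the least isolation constants are non-decreasing in the (even) number of bits.
[this work] -/
theorem theta_mono {n n' : ℕ} (hn : Even n) (hn' : Even n') (hle : n ≤ n') {θ θ' : ℝ}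
    (hθ : IsLeast {θ : ℝ | ∀ f g : (Fin n → Bool) → Bool, IsDegLeFun 3 f → IsDegLeFun 3 g →
      θ < forrelation f g → forrelation f g = 1} θ)
    (hθ' : IsLeast {θ : ℝ | ∀ f g : (Fin n' → Bool) → Bool, IsDegLeFun 3 f → IsDegLeFun 3 g →
      θ < forrelation f g → forrelation f g = 1} θ') : θ ≤ θ' :=
  hθ.2 (isolates_mono hn hn' hle hθ'.1)

/-! ### The upper envelope: the tower's rate, uniform in `n` -/

/-- **The tower's rate, uniform in `n`.** For every `m ≥ 3` and all cubic `f, g : 𝔽₂^{m+m} → 𝔽₂`: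
`Φ(f,g) > 1 − 2^{−(⌊2m/3⌋+1)} ⇒ Φ(f,g) = 1`.  Bent `g`: the dual has degree `≤ ⌊(m+3)/2⌋` (Hou), so `Φ = 1` or
`Φ ≤ 1 − 2^{1−⌊(m+3)/2⌋} ≤ 1 − 2^{−(⌊2m/3⌋+1)}` (`tw_bent_end`); non-bent `g`: the 2-adic tower walk `tower_walk_closed` with the
uniform cost exponent `C = ⌊2m/3⌋ + 1` — every level `⌈2m/3⌉ ≤ j < m` has cost exponent `⌊(3j−2m)/2⌋ + 1 + 2(m−j) ≤ C` (worst at the Ax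
base) and the top level `⌊m/2⌋ + 1 ≤ C`.  Per `n = 2m` this is `θ_n ≤ 1 − 2^{−⌊n/3⌋−1}`.  NOT summit progress: the constant tends to `1`.
[this work] -/
theorem isolation_rate (m : ℕ) (hm : 3 ≤ m) (f g : (Fin (m + m) → Bool) → Bool) (hf : IsDegLeFun 3 f) (hg : IsDegLeFun 3 g)
    (hΦ : 1 - (1 / 2 : ℝ) ^ (2 * m / 3 + 1) < forrelation f g) : forrelation f g = 1 := by
  by_cases hbent : ∀ x, W (fun y => signOf (g y)) x ^ 2 = (2 : ℝ) ^ (m + m)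
  · rcases tw_bent_end hm f g hf hg hbent with h | h
    · exact h
    · exfalso
      have e : (2 : ℝ) / 2 ^ ((m + 3) / 2) = (1 / 2) ^ ((m + 3) / 2 - 1) := by
        obtain ⟨a, ha⟩ : ∃ a, (m + 3) / 2 = a + 1 := ⟨(m + 3) / 2 - 1, by omega⟩
        rw [ha, pow_succ, one_div_pow, Nat.add_sub_cancel]
        field_simp
      have hle : (1 / 2 : ℝ) ^ (2 * m / 3 + 1) ≤ 2 / 2 ^ ((m + 3) / 2) := by
        rw [e]
        exact pow_le_pow_of_le_one (by norm_num) (by norm_num) (by omega)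
      linarith
  · rcases tower_walk_closed m (2 * m / 3 + 1) g hg (by omega) (by intro j hj₀ hjm; omega) (by omega) with h | h
    · exact absurd h hbent
    · have := tw_forrelation_le_of_cap f g h
      linarith

/-- **The rate in the crux's shape:** for every even `n ≥ 6` and all cubic `f, g : 𝔽₂ⁿ → 𝔽₂`,
`Φ(f,g) > 1 − 2^{−(⌊n/3⌋+1)} ⇒ Φ(f,g) = 1`. [this work] -/
theorem isolation_rate_even : ∀ n : ℕ, Even n → 6 ≤ n → ∀ f g : (Fin n → Bool) → Bool,
    IsDegLeFun 3 f → IsDegLeFun 3 g → 1 - (1 / 2 : ℝ) ^ (n / 3 + 1) < forrelation f g → forrelation f g = 1 := by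
  intro n he h6 f g hf hg hlt
  obtain ⟨m, rfl⟩ := he
  have e : (m + m) / 3 = 2 * m / 3 := by omega
  rw [e] at hlt
  exact isolation_rate m (by omega) f g hf hg hlt

/-- **First row beyond the tree's range: `θ_30 ≤ 2047/2048`.** For all cubic `f, g : 𝔽₂³⁰ → 𝔽₂`, `Φ(f,g) > 2047/2048 ⇒ Φ(f,g) = 1`
(the rate at `m = 15`; the tree's `isolation_window_le_28` stops at `n = 28`).  Finite-slice verdict; NOT summit progress. [this work] -/
theorem isolation_thirty (f g : (Fin (15 + 15) → Bool) → Bool) (hf : IsDegLeFun 3 f) (hg : IsDegLeFun 3 g)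
    (hΦ : (2047 / 2048 : ℝ) < forrelation f g) : forrelation f g = 1 :=
  isolation_rate 15 (by norm_num) f g hf hg (by norm_num; linarith)

/-! ### The lower envelope from `n = 16` on, and the crux as a tail statement -/

/-- **No `θ < 15/16` isolates exactness at any even `n ≥ 16`:** if `θ` isolates exactness for cubic pairs on `n` bits (`n ≥ 16`
even) then `θ ≥ 15/16` — by monotonicity down to `n = 16`, where `Φ(f16,g16) = 15/16 ≠ 1` (`theta_sixteen_bounds_31_32`).
So `θ_n ≥ 15/16` for every even `n ≥ 16`. [this work] -/
theorem le_of_isolates_ge_sixteen {θ : ℝ} {n : ℕ} (hn : Even n) (h16 : 16 ≤ n)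
    (h : ∀ f g : (Fin n → Bool) → Bool, IsDegLeFun 3 f → IsDegLeFun 3 g → θ < forrelation f g → forrelation f g = 1) :
    15 / 16 ≤ θ :=
  theta_sixteen_bounds_31_32.2 θ (isolates_mono (by decide) hn h16 h)

/-- **`θ_20 ∈ [15/16, 127/128]`** — a new row of the ladder at the literal type `Fin 20`, from the two envelopes: isolation above
`127/128 = 1 − 2⁻⁷` (the rate at `m = 10`; the tree had `1 − 2⁻¹⁰` at `n = 20`) and no isolation below `15/16` (monotonicity from
`n = 16`).  The window `(15/16, 127/128]` is NOT decided.  Finite-slice verdict; NOT summit progress. [this work] -/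
theorem theta_twenty_bounds :
    (∀ f g : (Fin 20 → Bool) → Bool, IsDegLeFun 3 f → IsDegLeFun 3 g →
        (127 / 128 : ℝ) < forrelation f g → forrelation f g = 1) ∧
    ∀ θ : ℝ, (∀ f g : (Fin 20 → Bool) → Bool, IsDegLeFun 3 f → IsDegLeFun 3 g →
        θ < forrelation f g → forrelation f g = 1) → 15 / 16 ≤ θ :=
  ⟨fun f g hf hg h => isolation_rate 10 (by norm_num) f g hf hg (by norm_num at h ⊢; linarith),
    fun _ hθ => le_of_isolates_ge_sixteen (by decide) (by norm_num) hθ⟩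

/-- **The crux is a statement about the tail of the ladder.**  `NearExactIsExact` holds iff some `θ < 1` isolates exactness for
cubic pairs on every even `n` FROM SOME `N` ON: by monotonicity (`isolates_mono`) isolation at all large even `n` propagates down
to every even `n`, so ANY tail suffices and no separate small-`n` analysis is needed (compare `nearExactIsExact_iff_from_thirty`,
which spends the certified constants below `30`).  Equivalently: the non-decreasing sequence `θ_n` (`≥ 15/16` from `n = 16` on)
has `sup_n θ_n = lim_n θ_n < 1`. [this work] -/
theorem nearExactIsExact_iff_eventually :
    NearExactIsExact ↔ ∃ θ : ℝ, θ < 1 ∧ ∃ N : ℕ, ∀ n : ℕ, Even n → N ≤ n → ∀ f g : (Fin n → Bool) → Bool,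
      IsDegLeFun 3 f → IsDegLeFun 3 g → θ < forrelation f g → forrelation f g = 1 := by
  constructor
  · rintro ⟨θ, hθ, h⟩
    exact ⟨θ, hθ, 0, fun n hn _ => h n hn⟩
  · rintro ⟨θ, hθ, N, h⟩
    refine ⟨θ, hθ, fun n hn f g hf hg hlt => ?_⟩
    exact isolates_mono hn (hn.add (even_two_mul N)) (by omega) (h (n + 2 * N) (hn.add (even_two_mul N)) (by omega))
      f g hf hg hlt

/-- **Any eventual isolation constant is at least `15/16`:** if `θ` isolates exactness for cubic pairs on every even `n ≥ N`, then
`θ ≥ 15/16` (take an even `n ≥ max N 16` and use `le_of_isolates_ge_sixteen`).  With `nearExactIsExact_iff_eventually`: the crux is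
`∃ θ ∈ [15/16, 1), ∃ N, ∀ even n ≥ N, Isol_n(θ)`. [this work] -/
theorem le_of_isolates_eventually {θ : ℝ} {N : ℕ}
    (h : ∀ n : ℕ, Even n → N ≤ n → ∀ f g : (Fin n → Bool) → Bool,
      IsDegLeFun 3 f → IsDegLeFun 3 g → θ < forrelation f g → forrelation f g = 1) : 15 / 16 ≤ θ :=
  le_of_isolates_ge_sixteen (n := 16 + 2 * N) ((show Even 16 by decide).add (even_two_mul N)) (by omega)
    (h (16 + 2 * N) ((show Even 16 by decide).add (even_two_mul N)) (by omega))

end Summit.QuantumAdvantage.QuantumAdvantage.Theorems.CubicForrelation.NearExactIsExact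

end
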